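import Summits.Ventures.YMGap.Thresholds.OneLinkTiltStability
import Summits.Ventures.YMGap.Thresholds.OneLinkEigenModulus
import Summits.Ventures.YMGap.Thresholds.QuarterModulusTwoThirds
import Summits.QuantumFields.BalabanUV.InfraRed.StrongCouplingPoincareDoorSUN
import HarnessLib

/-!
# Venture YMGap — ROBUST-BALL input, part 3: the perturbed one-link schema `OneLinkKRModulusTilt N R δ ℓ K` and its rows
# (every one-link modulus of the tree, transferred to bounded Lipschitz re-weightings)

HONEST FRAMING: venture file of the cell `pub-ymgap` (QuantumFields programme), track Y2 ROBUST-BALL; one-link bookkeeping on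
`SU(N)`.  Nothing about a perturbed lattice specification, a door on the ball, the continuum or a mass gap is said here.

CONTENT.  `OneLinkKRModulusTilt N R δ ℓ K` — the one-link Kantorovich–Rubinstein modulus of the PERTURBED family
`ν_{B,U}(dg) ∝ exp(N Re tr(g B) + U(g)) dg`, uniformly over measurable `U` of oscillation `≤ δ` and Frobenius-Lipschitz constant
`≤ ℓ` (the schema `OneLinkKRModulus N R K` of `StrongCouplingDobrushinWindow` is the case `U = const`).  The transfer
`oneLinkKRModulusTilt_of_oneLinkKRModulus : OneLinkKRModulus N R K → OneLinkKRModulusTilt N R δ ℓ (K e^δ (1 + 2√N ℓ))`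
(`ℓ ≥ 0`; part 2's `su_oneLink_transfer_add`), consistency (`U = 0`), monotonicity, and the ROWS — every modulus the tree
holds, transferred: Bakry–Émery `1/(1/2 − R)` hypothesis-free for `N ≥ 2` (`oneLinkKRModulus_SU`); the eigen-modulus
`(N²/(N²−1))(1/2 + 2R)/(1/2 − R)` hypothesis-free (`OneLinkEigen.oneLinkKRModulus_eigen`); the `SU(2)` QUARTER modulus
(`K = 4 · (1/4) = 1` on `‖B‖_op ≤ 3β_W/2`, every `β_W ≤ 2/3`, hypothesis-free — the input of the `9/25` column); and the
Poincaré × variance modulus `√(cv)` on the two named certificate schemas (`oneLinkKRModulus_of_poincare_of_varianceBound`), e.g.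
the cell's certified `SU(3)` pair.  For the √(cv) rows the Holley–Stroock route of `OneLinkHolleyStroock` (engine-2 lineage) gives
the `ℓ`-free factor `e^δ`; both are valid and a robust door takes the minimum.
-/

noncomputable section

open MeasureTheory ProbabilityTheory Real
open Literature.MathematicalPhysics.QuantumFieldTheory
open Literature.MathematicalPhysics.QuantumFieldTheory.Balaban1983to89.StrongCouplingDobrushinWindow
open Literature.MathematicalPhysics.QuantumFieldTheory.Balaban1983to89.StrongCouplingKernelWindow (oneLinkKRModulus_SU)
open Summit.QuantumFields.BalabanUV.InfraRed.StrongCouplingPoincareDoorSUN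
open Summit.QuantumFields.BalabanUV.InfraRed.StrongCouplingVarianceDoorSUN (OneLinkVarianceBound)
open Summit.Ventures.YMGap.OneLinkTiltStability

namespace Summit.Ventures.YMGap.OneLinkTiltSchema

variable {N : ℕ}

/-- **One-link Kantorovich–Rubinstein modulus of the PERTURBED family** `ν_{B,U}(dg) ∝ exp(N Re tr(g B) + U(g)) dg` on `SU(N)`,
uniformly over the perturbations `U` that are measurable, of oscillation `≤ δ` (`U a − U b ≤ δ` for all `a, b`) and
`ℓ`-Lipschitz for the Frobenius distance: on the operator-norm ball `‖B‖_op ≤ R`, for every bounded measurable `L`-Lipschitz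
`φ`, `|ν_{B,U}(φ) − ν_{B',U}(φ)| ≤ K · L · ‖B − B'‖_F`.  At `δ = ℓ = 0` only constant `U` qualify and this is the schema
`OneLinkKRModulus N R K` (`OneLinkKRModulusTilt.toOneLinkKRModulus`).  In a perturbed lattice action `S_Wilson + Σ_X W_X`
the conditional law of one link given the exterior `ω` is `ν_{B_ω, U_ω}` with `U_ω(g) = −Σ_{X ∋ link} W_X(ω with the link set
to g)`, so `δ ≤ Σ_{X ∋ link} osc_link W_X` and `ℓ ≤ Σ_{X ∋ link} Lip_link(W_X)` — the oscillation and self-Lipschitz LOADS of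
the ROBUST-BALL design.  A hypothesis schema / bookkeeping predicate (tagged like the cell's other one-link schemas); nothing
is asserted by the definition. [folklore] -/
@[conjecture]
def OneLinkKRModulusTilt (N : ℕ) (R δ ℓ K : ℝ) : Prop :=
  ∀ U : Matrix.specialUnitaryGroup (Fin N) ℂ → ℝ, Measurable U → (∀ a b, U a - U b ≤ δ) →
    (∀ a b, |U a - U b| ≤ ℓ * suFrobDist a b) →
    ∀ B B' : Matrix (Fin N) (Fin N) ℂ, matrixOpNorm B ≤ R → matrixOpNorm B' ≤ R →
    ∀ (φ : Matrix.specialUnitaryGroup (Fin N) ℂ → ℝ) (L : ℝ), Measurable φ → (∃ M, ∀ s, |φ s| ≤ M) → 0 ≤ L →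
      (∀ a b, |φ a - φ b| ≤ L * suFrobDist a b) →
      |∫ s, φ s ∂((haarProbability (Matrix.specialUnitaryGroup (Fin N) ℂ)).tilted
            fun g => (N : ℝ) * ((g : Matrix (Fin N) (Fin N) ℂ) * B).trace.re + U g) -
          ∫ s, φ s ∂((haarProbability (Matrix.specialUnitaryGroup (Fin N) ℂ)).tilted
            fun g => (N : ℝ) * ((g : Matrix (Fin N) (Fin N) ℂ) * B').trace.re + U g)| ≤
        K * L * frobNorm (B - B')

/-- **THE TRANSFER, packaged**: `OneLinkKRModulus N R K → OneLinkKRModulusTilt N R δ ℓ (K e^δ (1 + 2√N ℓ))` for every `δ` and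
every `ℓ ≥ 0` (part 2's `su_oneLink_transfer_add`). [folklore] -/
theorem oneLinkKRModulusTilt_of_oneLinkKRModulus {R K δ ℓ : ℝ} (hK : OneLinkKRModulus N R K) (hℓ : 0 ≤ ℓ) :
    OneLinkKRModulusTilt N R δ ℓ (K * exp δ * (1 + 2 * Real.sqrt N * ℓ)) :=
  fun U hUm hUδ hUℓ B B' hB hB' φ L hφm hφb hL hφL =>
    su_oneLink_transfer_add hK hℓ U hUm hUδ hUℓ B B' hB hB' φ L hφm hφb hL hφL

/-- Consistency: the perturbed schema at any `δ, ℓ ≥ 0` contains the unperturbed one (`U = 0`). [folklore] -/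
theorem OneLinkKRModulusTilt.toOneLinkKRModulus {R δ ℓ K : ℝ} (h : OneLinkKRModulusTilt N R δ ℓ K) (hδ : 0 ≤ δ)
    (hℓ : 0 ≤ ℓ) : OneLinkKRModulus N R K := by
  intro B B' hB hB' φ L hφm hφb hL hφL
  have key := h (fun _ => 0) measurable_const (fun _ _ => by simpa using hδ)
    (fun a b => by simpa using mul_nonneg hℓ (suFrobDist_nonneg a b)) B B' hB hB' φ L hφm hφb hL hφL
  simpa only [add_zero] using key

/-- Monotonicity of the perturbed schema: smaller ball, smaller oscillation and Lipschitz budgets, larger constant. [folklore] -/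
theorem OneLinkKRModulusTilt.mono {R R' δ δ' ℓ ℓ' K K' : ℝ} (h : OneLinkKRModulusTilt N R δ ℓ K) (hR : R' ≤ R)
    (hδ : δ' ≤ δ) (hℓ : ℓ' ≤ ℓ) (hK : K ≤ K') : OneLinkKRModulusTilt N R' δ' ℓ' K' := by
  intro U hUm hUδ hUℓ B B' hB hB' φ L hφm hφb hL hφL
  have key := h U hUm (fun a b => (hUδ a b).trans hδ)
    (fun a b => (hUℓ a b).trans (mul_le_mul_of_nonneg_right hℓ (suFrobDist_nonneg a b)))
    B B' (hB.trans hR) (hB'.trans hR) φ L hφm hφb hL hφL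
  exact key.trans (mul_le_mul_of_nonneg_right (mul_le_mul_of_nonneg_right hK hL) (frobNorm_nonneg _))

/-! ## Rows: every one-link modulus of the tree, transferred -/

/-- **Row BE (hypothesis-free, every `N ≥ 2`)**: Shen–Zhu–Zhu's Bakry–Émery modulus `1/(1/2 − R)` (`oneLinkKRModulus_SU`, the
one-link Poincaré inequality proved in the tree) transfers: `OneLinkKRModulusTilt N R δ ℓ (e^δ (1 + 2√N ℓ)/(1/2 − R))`, `R < 1/2`.
[folklore] -/
theorem oneLinkKRModulusTilt_bakryEmery (hN : 2 ≤ N) {R δ ℓ : ℝ} (hR : R < 1 / 2) (hℓ : 0 ≤ ℓ) :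
    OneLinkKRModulusTilt N R δ ℓ (exp δ * (1 + 2 * Real.sqrt N * ℓ) / (1 / 2 - R)) := by
  have := oneLinkKRModulusTilt_of_oneLinkKRModulus (δ := δ) (oneLinkKRModulus_SU hN hR) hℓ
  refine this.mono le_rfl le_rfl le_rfl (le_of_eq ?_)
  ring

/-- **Row EIGEN (hypothesis-free, every `N ≥ 2`)**: the Laplacian-eigenfunction modulus `(N²/(N²−1)) (1/2 + 2R)/(1/2 − R)`
(`OneLinkEigen.oneLinkKRModulus_eigen`) transfers with the factor `e^δ (1 + 2√N ℓ)`. [folklore] -/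
theorem oneLinkKRModulusTilt_eigen (hN : 2 ≤ N) {R δ ℓ : ℝ} (hR : R < 1 / 2) (hℓ : 0 ≤ ℓ) :
    OneLinkKRModulusTilt N R δ ℓ
      ((N : ℝ) ^ 2 / ((N : ℝ) ^ 2 - 1) * ((1 / 2 + 2 * R) / (1 / 2 - R)) * exp δ * (1 + 2 * Real.sqrt N * ℓ)) :=
  oneLinkKRModulusTilt_of_oneLinkKRModulus (OneLinkEigen.oneLinkKRModulus_eigen hN hR) hℓ

/-- **Row SU(2) QUARTER (hypothesis-free, every `β_W ≤ 2/3`)**: the `SU(2)` quarter modulus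
`OneLinkKRModulusSU2 β_W (1/4) = OneLinkKRModulus 2 (3β_W/2) 1` (`QuarterModulusTwoThirds.oneLinkKRModulusSU2_of_le_twoThirds`, the
input of the `9/25` star column and of the single-link door `2/9`) transfers: `OneLinkKRModulusTilt 2 (3β_W/2) δ ℓ (e^δ (1 + 2√2 ℓ))`.
[folklore] -/
theorem su2_oneLinkKRModulusTilt_quarter {βW δ ℓ : ℝ} (hβ : βW ≤ 2 / 3) (hℓ : 0 ≤ ℓ) :
    OneLinkKRModulusTilt 2 (3 * βW / 2) δ ℓ (exp δ * (1 + 2 * Real.sqrt 2 * ℓ)) := by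
  have hq : OneLinkKRModulus 2 (3 * βW / 2) (4 * (1 / 4)) :=
    QuarterModulusTwoThirds.oneLinkKRModulusSU2_of_le_twoThirds hβ
  have := oneLinkKRModulusTilt_of_oneLinkKRModulus (δ := δ) hq hℓ
  refine this.mono le_rfl le_rfl le_rfl (le_of_eq ?_)
  push_cast
  ring

/-- **Row √(cv) (on the two named certificate schemas)**: a Lipschitz-Poincaré constant `OneLinkPoincareSUN N R c` and a
variance bound `OneLinkVarianceBound N R v` (`c, v ≥ 0`) give the modulus `√(cv)` (`oneLinkKRModulus_of_poincare_of_varianceBound`),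
hence `OneLinkKRModulusTilt N R δ ℓ (√(cv) e^δ (1 + 2√N ℓ))`.  (For these rows the Holley–Stroock route, engine-2's
`OneLinkHolleyStroock`, gives the `ℓ`-free constant `e^δ √(cv)`; a robust door uses the smaller of the two.) [folklore] -/
theorem oneLinkKRModulusTilt_of_poincare_of_varianceBound {R c v δ ℓ : ℝ} (hc : 0 ≤ c) (hv0 : 0 ≤ v)
    (hP : OneLinkPoincareSUN N R c) (hv : OneLinkVarianceBound N R v) (hℓ : 0 ≤ ℓ) :
    OneLinkKRModulusTilt N R δ ℓ (Real.sqrt (c * v) * exp δ * (1 + 2 * Real.sqrt N * ℓ)) :=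
  oneLinkKRModulusTilt_of_oneLinkKRModulus (oneLinkKRModulus_of_poincare_of_varianceBound hc hv0 hP hv) hℓ

/-- **Row SU(3) CERTIFIED (the cell's pair, displayed)**: `OneLinkPoincareSUN 3 (11/30) (4/5)` and `OneLinkVarianceBound 3 (11/30) (49/20)`
(the certified computations behind the `11/20` star rows, R137 classes) give `OneLinkKRModulusTilt 3 (11/30) δ ℓ ((7/5) e^δ (1 + 2√3 ℓ))`
(`√((4/5)(49/20)) = 7/5`). [folklore] -/
theorem su3_oneLinkKRModulusTilt_certified {δ ℓ : ℝ} (hP : OneLinkPoincareSUN 3 (11 / 30) (4 / 5))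
    (hv : OneLinkVarianceBound 3 (11 / 30) (49 / 20)) (hℓ : 0 ≤ ℓ) :
    OneLinkKRModulusTilt 3 (11 / 30) δ ℓ (7 / 5 * exp δ * (1 + 2 * Real.sqrt 3 * ℓ)) := by
  have h := oneLinkKRModulusTilt_of_poincare_of_varianceBound (δ := δ) (by norm_num) (by norm_num) hP hv hℓ
  have hs : Real.sqrt (4 / 5 * (49 / 20)) = 7 / 5 := by
    rw [show (4 : ℝ) / 5 * (49 / 20) = (7 / 5) ^ 2 by norm_num, Real.sqrt_sq (by norm_num)]
  rw [hs] at h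
  exact_mod_cast h

end Summit.Ventures.YMGap.OneLinkTiltSchema
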